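import Summits.ABC.IUTFork.Repair.RHHeightScalingMultiL
import Summits.ABC.IUTFork.Repair.RHHeightScalingBarrier
import HarnessLib

/-!
# R-H ROUND 4, row R4OBJ-FACES — KERNEL FACE for the R4-6 class (ii) «MULTI-PRIME PACKETS» (census O-07), BARRIER side: a finite ν-pooling of
# price-bounded per-`l` packets never closes the POOLED requirement `s·Σν_l M_l − tol` beyond the explicit dilation `(Σν_l P_l + tol)/(Σν_l M_l)`
# (PROOF-ONLY, 0 definitions)

abc-iut cell, rung LADDER-ABC:A2.RESCUE.H, ROUND 4 (HUMAN D-0133 · D-0134 · D-0135; KEY `wake/KEY-abc-iut-rh2-w-2-R4OBJ-FACES.md`, abc-iut-rh-lead g5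
2026-08-27T13:46:57Z; referee rh-ref-2). Seat abc-iut-rh2-w-2. INPUT OF RECORD: abc-iut-rh2-q2-eq's R4OBJ-MULTIL memo `plan/rescue/R-H/ROUND4/R4-6-MULTIL-rh2-q2-eq.md`
(v1.1; §2 mediant law (R1)/(R2), §4 kernel face ★ p537489 `Repair/RHHeightScalingMultiL.lean`: `sum_kept_le_sum_cap`, `priceBounded_pool`, `negExponent_pool`,
`not_doorAt_pool` — the DOOR-vocabulary faces of the class are the class seat's and are NOT restated). THIS FILE adds the BARRIER-vocabulary face (this seat's
p531802 `RHHeightScalingBarrier`: `ClosedBy`, `NeverClosedFrom`, `not_closedBy_of_heightFree`) for the same pooled object: the pooled kept mass `Σ_Λ ν_l·K_l(s)` is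
capped by the height-free `Σ_Λ ν_l·P_l` (q2-eq `sum_kept_le_sum_cap`) while the pooled requirement is `s·Σ_Λ ν_l·M_l − tol`, so no closing beyond
`s₀ = (Σν P + tol)/(Σν M)` — exponent `−1`, «combining `l` re-averages the constant and changes no exponent» (q2-eq §2 (a)) in `ClosedBy` currency.
WHAT IS PROVED (namespace `Summit.ABC.IUTFork.Repair.RH.HeightScalingR4.MultiLFace`, [folklore] real analysis): **`multiL_not_closedBy`** (∀ `s ≥ 1` with
`(Σν P + tol)/(Σν M) < s`: `¬ ClosedBy (pooled kept) (Σν M) tol s`), **`multiL_neverClosedFrom`** (explicit onset `max 1 ((Σν P + tol)/(Σν M) + 1)`),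
and the MEDIANT reading (pooled threshold `≤` the worst packet's) is q2-eq's `sum_cap_le_mul_sum_mass` BY NAME (not restated).
HONEST FRAMING: arithmetic about OUR typed cell currency; the multi-`l` packet is the class seat's object (a multi-`l` Θ-link is NOT an object of [IUTchI–IV] —
located, not adjudicated, q2-eq §5); nothing here asserts that abc is proved or refuted, or takes a side on [IUTchIII] Cor. 3.12 / [IUTchIV] Thm. 1.10 or on any
author; KILLED-BY-CONSISTENCY (as a door) is a word about OUR profiles; typed ≠ proved; computed ≠ proved.
-/

noncomputable section

namespace Summit.ABC.IUTFork.Repair.RH.HeightScalingR4.MultiLFace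

open Finset Summit.ABC.IUTFork.Repair.RH.HeightScaling Summit.ABC.IUTFork.Repair.RH.HeightScalingBarrier
  Summit.ABC.IUTFork.Repair.RH.HeightScalingMultiL

variable {ι : Type*}

/-- **O-07 BARRIER FACE: a finite pooling of price-bounded packets never closes the pooled requirement beyond `(Σν P + tol)/(Σν M)`.** With `ν_l ≥ 0`,
per-packet height-free caps `K_l(s) ≤ P_l` (`s ≥ 1`; the EXP-2 / class-(ii) law of record) and pooled mass slope `Σ_Λ ν_l·M_l > 0`: for every `s ≥ 1` with
`(Σν P + tol)/(Σν M) < s`, the pooled kept mass does not close `s·Σν M − tol` (p531802 `not_closedBy_of_heightFree` ∘ q2-eq `sum_kept_le_sum_cap`). [folklore] -/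
theorem multiL_not_closedBy (Λ : Finset ι) (ν P M : ι → ℝ) (K : ι → ℝ → ℝ) (tol : ℝ) (hν : ∀ l ∈ Λ, 0 ≤ ν l)
    (hK : ∀ l ∈ Λ, ∀ s : ℝ, 1 ≤ s → K l s ≤ P l) (hM : 0 < ∑ l ∈ Λ, ν l * M l) {s : ℝ} (h1 : 1 ≤ s)
    (hs : (∑ l ∈ Λ, ν l * P l + tol) / (∑ l ∈ Λ, ν l * M l) < s) :
    ¬ ClosedBy (fun _ : Fin 1 => fun s' => ∑ l ∈ Λ, ν l * K l s') (∑ l ∈ Λ, ν l * M l) tol s := by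
  refine not_closedBy_of_heightFree (C := fun _ : Fin 1 => ∑ l ∈ Λ, ν l * P l) (s₁ := 1) hM
    (fun _ s' hs' => sum_kept_le_sum_cap Λ ν P K hν hK hs') h1 ?_
  simpa using hs

/-- **`NeverClosedFrom` for the pooled multi-`l` object**, explicit onset `max 1 ((Σν P + tol)/(Σν M) + 1)`. [folklore] -/
theorem multiL_neverClosedFrom (Λ : Finset ι) (ν P M : ι → ℝ) (K : ι → ℝ → ℝ) (tol : ℝ) (hν : ∀ l ∈ Λ, 0 ≤ ν l)
    (hK : ∀ l ∈ Λ, ∀ s : ℝ, 1 ≤ s → K l s ≤ P l) (hM : 0 < ∑ l ∈ Λ, ν l * M l) :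
    NeverClosedFrom (fun _ : Fin 1 => fun s' => ∑ l ∈ Λ, ν l * K l s') (∑ l ∈ Λ, ν l * M l) tol
      (max 1 ((∑ l ∈ Λ, ν l * P l + tol) / (∑ l ∈ Λ, ν l * M l) + 1)) := fun s hs =>
  multiL_not_closedBy Λ ν P M K tol hν hK hM (le_trans (le_max_left _ _) hs)
    (by linarith [le_trans (le_max_right _ _) hs])

/- The MEDIANT reading «pooling never raises the threshold above the worst packet's» (`P_l ≤ c·M_l` on `Λ` ⇒ `Σν P ≤ c·Σν M`) is ALREADY
abc-iut-rh2-q2-eq's `RH.HeightScalingMultiL.sum_cap_le_mul_sum_mass` (p537489) — cited BY NAME, not restated (gate dedup 2026-08-27T14:4xZ). -/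

end Summit.ABC.IUTFork.Repair.RH.HeightScalingR4.MultiLFace

end
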